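import Literature.MathematicalPhysics.QuantumFieldTheory.Balaban1983to89.B7Prop4GeneralLevels
import Literature.MathematicalPhysics.QuantumFieldTheory.Balaban1983to89.B7Prop3GeneralTild
import Literature.MathematicalPhysics.QuantumFieldTheory.Balaban1983to89.B8Ineq132

/-!
# `Balaban1983to89.B7Eq43AveragingContinuity` — [Balaban1985Averaging] (42)–(43), (120)–(127): THE AVERAGING MACHINERY IS CONTINUOUS IN THE
# CONFIGURATION in the small-field regime where it is defined — the one-step average `V̄_c = exp[Σ L^{−d} log V(Γ_{c,x})V(c)⁻¹]V(c)` (42), its iterates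
# `V̄ʲ` (43), and the linearised averaging operators `L(Q(V₀)A)` (122) ∕ `Q_j(U₀)` (127) (jointly in the background and the field) — the analytic
# input of the per-member road to [Balaban1985BackgroundPropagators] Theorem 3.11 (`B9Thm311PosDefOpenZd.LettersContinuousWithinAt`)

statement-level skeleton of published theorems with citation tags; proofs where landed; nothing here is a claim about the
Yang–Mills mass gap

`[Balaban1985Averaging]` ("B7" ∕ [5], CMP **98** (1985) 17–51) p. 23 (42): *«V̄_c := exp[i Σ_{x∈B(c₋)} L^{−d} (1/i) log V(Γ_{c,x})V(c)⁻¹] V(c)»*, p. 24 (43)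
(its iteration `V̄^{k+1} = \overline{(V̄^k)}`), p. 21: the logarithm is the power series (21), defined for `|V(Γ_{c,x})V(c)⁻¹ − 1| < 1`; p. 36
(120)–(122): *«Q(V₀, A, c) is an analytic function of A … its Taylor expansion begins with a first-order polynomial. Let us denote it by
L(Q(V₀)A)_c»*; p. 37 (127) (the composite `Q_j`).  Every object on these pages is a FINITE composition of bond variables, their products along
contours, `exp`, and the series `log` ∕ `D log` ∕ `D exp` inside their discs of convergence — hence CONTINUOUS in the configuration there; print uses
this tacitly throughout (e.g. [Balaban1985BackgroundPropagators] p. 416, perturbing Theorem 3.11 around `U = 1`).  THIS FILE records exactly that and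
nothing more.  PDF held: `paper:balaban1985-cmp98-averaging` pp. 21–24, 34–37 (re-read by this seat, 2026-08-28).

CITATION HEADER (lean-in-tree rule).  Cell `pub-ymgap` (YM Track A, HUMAN RULING D-0062 ∕ D-0149 width push), DAG node N06 = [B9], width seat
`pub-ymgap-dag-n06-w4` (g3), FILE 3 of the IDEA-3.11 STEP (ii) road (FILE 1 `B9Thm311PosDefOpenZd` p605686: positivity is open in the background GIVEN
letter continuity; FILE 2 `B9Eq310DeltaPrimeContinuityZd`: the `Δ′` letter).  The remaining letters `Q*aQ(U₀)` and `D R(U₀) 𝟙D*` read the background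
through the AVERAGED TRANSPORTERS `Ū₀ʲ` and the linearised averaging `Q_j(U₀)`; this file supplies their continuity.  Objects (all the tree's, cited by
name, none restated): `hol ∕ stepHol ∕ Wcx ∕ Xavg ∕ bavg ∕ expUnit` (`B7Prop1Explicit`, unit b7-g*), `rescale ∕ avgIter` (`B7Prop2Explicit`),
`tstep ∕ tsum` (`B7Prop3GeneralRotated`), `FhatCov ∕ linQcov` (`B7Prop3GeneralLinear`), `Aloop ∕ DXavg ∕ QprimeCov ∕ linQcov_eq` (`B7Prop3GeneralTild`),
`Dmlog ∕ Dexp ∕ PhiY` (`B12AverageCorridor267`), `mlog ∕ analyticAt_mlog` (`MatrixLog`), `linCovIter` (`B7Prop4GeneralLevels`).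

WHAT IS PROVED (kernel, 0 sorry; theorems only — no `def`, `instance`, `notation`).  Throughout `V : Z → (bonds → 𝔸ˣ)` is a family of
configurations continuous at a parameter `z₀` (product topology), `A : Z → (bonds → 𝔸)` a family of fields continuous at `z₀`.
* §1 transports: `continuous_expUnit`; `continuousAt_bond`, `continuousAt_stepHol`, ★ `continuousAt_hol` (every contour holonomy `V(Γ)`),
  `continuousAt_Wcx` (the loop variables `V(Γ_{c,x})V(c)⁻¹` of (42)), `continuous_rescale`.
* §2 the average: `continuousAt_mlog_comp` (the series (21) along a family staying in its disc), ★ `continuousAt_Xavg` (the exponent of (42)),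
  ★★ `continuousAt_bavg` ∕ `continuousAt_bavg_cfg` ((42) at a configuration whose loop variables on the block are within `1` of `1`),
  ★★ `continuousAt_avgIter` ((43): `V ↦ V̄ʲ` continuous at `V₀` when all loop variables of all lower averages of `V₀` are within `1` of `1`),
  ★ `continuousAt_avgIter_one` (in particular at the flat configuration, every `j`).
* §3 the linearised average, jointly in (background, field): `continuousAt_tstep`, ★ `continuousAt_tsum` (the rotated sums `(R_{0,y}A)(Γ)`),
  `continuousAt_FhatCov` ((112)), `continuousAt_Aloop` ((114)–(115)), `continuous_Dexp` ∕ `continuousAt_Dmlog` (`D exp`, and `D log` inside the disc,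
  via analyticity), `continuousAt_DXavg` ((117)), `continuousAt_QprimeCov` ((119)), ★★ `continuousAt_linQcov` ((122) «L(Q(V₀)A)_c», via the closed form
  (120) = `linQcov_eq` on the open small-field set), ★★★ `continuousAt_linCovIter` ((127) `Q_j(U₀)A`, jointly; smallness at the averages `Ū₀ⁱ`, `i < j`),
  ★ `continuousAt_linCovIter_one` (at the flat background, every `j`).

HONEST SCOPE.  Continuity statements only, in the regime where print's series converge; no estimate of [5] (Props. 1–4) is proved or used beyond the
disc condition `‖V(Γ_{c,x})V(c)⁻¹ − 1‖ < 1`.  Count-neutral; N05 ∕ N06 NOT discharged; K1⁷ `stmt-QuantumFields-20542` NOT closed; Theorem 3.11 at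
curved `U₀` NOT proved; one finite `𝕋⁴` programme at fixed `ε`, Bałaban as printed; R4 closes only the conditional finite-`𝕋⁴` rung `BalabanLadder.UV`
— nothing continuum ∕ ℝ⁴ ∕ OS ∕ mass gap ∕ Clay.  Unit `pub-ymgap-dag-n06-w4` (g3), 2026-08-28.
-/

noncomputable section

namespace Literature.MathematicalPhysics.QuantumFieldTheory.Balaban1983to89.B7Eq43AveragingContinuity

open Filter Topology NormedSpace
open B7Prop1Explicit
open B7Prop2Explicit (rescale rescale_apply avgIter avgIter_zero avgIter_succ)
open B7Eq78Linearization (conjR)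
open B7Prop3GeneralRotated (tstep tsum)
open B7Prop3GeneralLinear (FhatCov linQcov)
open B7Prop3GeneralTild (Aloop DXavg QprimeCov linQcov_eq)
open B12AverageCorridor267 (Dmlog Dexp PhiY PhiY_apply hasFDerivAt_mlog hasFDerivAt_exp_Dexp)
open MatrixLog (mlog analyticAt_mlog)
open B7Prop4GeneralLevels (linCovIter linCovIter_zero linCovIter_succ)

-- `Site` alone could resolve to the torus sites of `Setup.lean`; re-export the `ℤ^d` sites of `B7Prop1Explicit`.
export B7Prop1Explicit (Site)

variable {d : ℕ} {𝔸 : Type*} [NormedRing 𝔸] [NormOneClass 𝔸] [NormedAlgebra ℂ 𝔸] [CompleteSpace 𝔸]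
variable {Z : Type*} [TopologicalSpace Z]

/-! ## §1  Transports: bond variables, contour holonomies, the loop variables of (42), rescaling -/

section Transport

omit [NormOneClass 𝔸] in
/-- `X ↦ e^X` as a unit is continuous (`exp` and `X ↦ e^{−X}` are). [cite: Balaban1985Averaging, (42) p.23 («exp[…]»)] -/
theorem continuous_expUnit : Continuous (expUnit : 𝔸 → 𝔸ˣ) := by
  letI : NormedAlgebra ℚ 𝔸 := NormedAlgebra.restrictScalars ℚ ℂ 𝔸
  refine Units.continuous_iff.2 ⟨?_, ?_⟩
  · exact exp_continuous.congr fun X => rfl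
  · have h : Continuous fun X : 𝔸 => exp (-X) := exp_continuous.comp continuous_neg
    refine h.congr fun X => ?_
    rw [val_inv_expUnit, val_expUnit]

variable {V : Z → Site d → Fin d → 𝔸ˣ} {z₀ : Z} (hV : ContinuousAt V z₀)
include hV

omit [NormOneClass 𝔸] [NormedAlgebra ℂ 𝔸] [CompleteSpace 𝔸] in
/-- a bond variable of a family of configurations continuous at `z₀` is continuous at `z₀`. [cite: Balaban1985Averaging, (9) p.18 (bookkeeping)] -/
theorem continuousAt_bond (x : Site d) (μ : Fin d) : ContinuousAt (fun z => V z x μ) z₀ := by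
  have h : Continuous fun U : Site d → Fin d → 𝔸ˣ => U x μ := (continuous_apply μ).comp (continuous_apply x)
  exact h.continuousAt.comp hV

omit [NormOneClass 𝔸] [NormedAlgebra ℂ 𝔸] [CompleteSpace 𝔸] in
/-- one letter of parallel transport (`V(b)` or `V(b)⁻¹`) is continuous in the configuration. [cite: Balaban1985Averaging, (9) p.18] -/
theorem continuousAt_stepHol (x : Site d) (l : Letter d) : ContinuousAt (fun z => stepHol (V z) x l) z₀ := by
  unfold stepHol
  by_cases h : l.2
  · simp only [h, if_true]; exact continuousAt_bond hV x l.1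
  · simp only [h]; exact (continuousAt_bond hV (x + l.vec) l.1).inv

omit [NormOneClass 𝔸] [NormedAlgebra ℂ 𝔸] [CompleteSpace 𝔸] in
/-- ★ **(9): EVERY CONTOUR HOLONOMY `V(Γ) = V(b₁)⋯V(b_n)` IS CONTINUOUS IN THE CONFIGURATION.** [cite: Balaban1985Averaging, (9) p.18] -/
theorem continuousAt_hol : ∀ (x : Site d) (w : List (Letter d)), ContinuousAt (fun z => hol (V z) x w) z₀
  | x, [] => by simp only [hol_nil]; exact continuousAt_const
  | x, l :: w => by
    simp only [hol_cons]
    exact (continuousAt_stepHol hV x l).mul (continuousAt_hol (x + l.vec) w)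

omit [NormOneClass 𝔸] [NormedAlgebra ℂ 𝔸] [CompleteSpace 𝔸] in
/-- **THE LOOP VARIABLES `V(Γ_{c,x})V(c)⁻¹` OF (42) ARE CONTINUOUS IN THE CONFIGURATION.** [cite: Balaban1985Averaging, (42) p.23] -/
theorem continuousAt_Wcx (L : ℕ) (q : Site d) (κ : Fin d) (r : Site d) : ContinuousAt (fun z => Wcx L (V z) q κ r) z₀ := by
  unfold Wcx
  exact (continuousAt_hol hV q _).mul (continuousAt_hol hV q _).inv

end Transport

omit [NormOneClass 𝔸] [NormedAlgebra ℂ 𝔸] [CompleteSpace 𝔸] in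
/-- the rescaling `Lℤᵈ ≅ ℤᵈ` of (43) is continuous (a re-indexing). [cite: Balaban1985Averaging, (43) p.24] -/
theorem continuous_rescale (L : ℕ) : Continuous (rescale L : (Site d → Fin d → 𝔸ˣ) → Site d → Fin d → 𝔸ˣ) := by
  refine continuous_pi fun z => continuous_pi fun κ => ?_
  exact (continuous_apply κ).comp (continuous_apply ((L : ℤ) • z))

/-! ## §2  The average (42) and its iterates (43) -/

section Average

variable (L : ℕ)

omit [NormOneClass 𝔸] in
/-- the logarithm series (21) along a family staying at a point of its disc of convergence is continuous there. [cite: Balaban1985Averaging, (21) p.21] -/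
theorem continuousAt_mlog_comp {W : Z → 𝔸ˣ} {z₀ : Z} (hW : ContinuousAt W z₀) (h : ‖(W z₀ : 𝔸) - 1‖ < 1) :
    ContinuousAt (fun z => mlog ((W z : 𝔸ˣ) : 𝔸)) z₀ := by
  have h1 : ContinuousAt (fun z => ((W z : 𝔸ˣ) : 𝔸)) z₀ := Units.continuous_val.continuousAt.comp hW
  exact ContinuousAt.comp (g := mlog) (f := fun z => ((W z : 𝔸ˣ) : 𝔸)) (analyticAt_mlog h).continuousAt h1

variable {V : Z → Site d → Fin d → 𝔸ˣ} {z₀ : Z} (hV : ContinuousAt V z₀)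
include hV

omit [NormOneClass 𝔸] in
/-- ★ **THE EXPONENT `X_c = Σ_{x∈B(c₋)} L^{−d} log V(Γ_{c,x})V(c)⁻¹` OF (42) IS CONTINUOUS IN THE CONFIGURATION** wherever all its loop variables are
within `1` of `1` (the disc of the series (21)). [cite: Balaban1985Averaging, (42) p.23, (21) p.21] -/
theorem continuousAt_Xavg (q : Site d) (κ : Fin d) (h : ∀ r : Fin d → Fin L, ‖((Wcx L (V z₀) q κ (boxVec L r) : 𝔸ˣ) : 𝔸) - 1‖ < 1) :
    ContinuousAt (fun z => Xavg L (V z) q κ) z₀ := by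
  unfold Xavg
  refine tendsto_finsetSum _ fun r _ => ?_
  exact ((continuousAt_mlog_comp (continuousAt_Wcx hV L q κ (boxVec L r)) (h r)).const_smul _)

omit [NormOneClass 𝔸] in
/-- ★★ **THE ONE-STEP AVERAGE (42) `V̄_c = exp[X_c]·V(c)` IS CONTINUOUS IN THE CONFIGURATION** at every configuration whose loop variables on the block
`B(c₋)` are within `1` of `1`. [cite: Balaban1985Averaging, (42) p.23] -/
theorem continuousAt_bavg (q : Site d) (κ : Fin d) (h : ∀ r : Fin d → Fin L, ‖((Wcx L (V z₀) q κ (boxVec L r) : 𝔸ˣ) : 𝔸) - 1‖ < 1) :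
    ContinuousAt (fun z => bavg L (V z) q κ) z₀ := by
  unfold bavg
  exact (continuous_expUnit.continuousAt.comp (continuousAt_Xavg L hV q κ h)).mul (continuousAt_hol hV q _)

omit [NormOneClass 𝔸] in
/-- **(42) AS A MAP OF CONFIGURATIONS** `V ↦ V̄` is continuous (product topology) at every `V₀` all of whose loop variables are within `1` of `1`.
[cite: Balaban1985Averaging, (42) p.23] -/
theorem continuousAt_bavg_cfg (h : ∀ (q : Site d) (κ : Fin d) (r : Fin d → Fin L), ‖((Wcx L (V z₀) q κ (boxVec L r) : 𝔸ˣ) : 𝔸) - 1‖ < 1) :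
    ContinuousAt (fun z => bavg L (V z)) z₀ :=
  continuousAt_pi.2 fun q => continuousAt_pi.2 fun κ => continuousAt_bavg L hV q κ (h q κ)

omit hV in
omit [NormOneClass 𝔸] in
/-- ★★ **(43): THE `j`-FOLD AVERAGE `V ↦ V̄ʲ` IS CONTINUOUS** (as a map of configurations) at every `V₀` such that, at every lower level `i < j`, all
loop variables of `V̄₀ⁱ` are within `1` of `1` (where each step of the iteration is defined by the series (21)). [cite: Balaban1985Averaging, (43) p.24, (42) p.23] -/
theorem continuousAt_avgIter {V₀ : Site d → Fin d → 𝔸ˣ} :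
    ∀ j : ℕ, (∀ i, i < j → ∀ (q : Site d) (κ : Fin d) (r : Fin d → Fin L),
      ‖((Wcx L (avgIter L V₀ i) q κ (boxVec L r) : 𝔸ˣ) : 𝔸) - 1‖ < 1) →
      ContinuousAt (fun V : Site d → Fin d → 𝔸ˣ => avgIter L V j) V₀
  | 0, _ => by simp only [avgIter_zero]; exact continuousAt_id
  | j + 1, h => by
    simp only [avgIter_succ]
    have hj := continuousAt_avgIter j fun i hi => h i (Nat.lt_succ_of_lt hi)
    exact (continuous_rescale L).continuousAt.comp
      (continuousAt_bavg_cfg L (V := fun V => avgIter L V j) hj (h j (Nat.lt_succ_self j)))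

omit hV in
omit [NormOneClass 𝔸] in
/-- ★ **AT THE FLAT CONFIGURATION every `V ↦ V̄ʲ` is continuous** (all averages of `1` are `1`, all loop variables `1`).
[cite: Balaban1985Averaging, (43) p.24] -/
theorem continuousAt_avgIter_one (j : ℕ) : ContinuousAt (fun V : Site d → Fin d → 𝔸ˣ => avgIter L V j) 1 := by
  refine continuousAt_avgIter L j fun i _ q κ r => ?_
  rw [B8Ineq132.avgIter_one, B8Ineq130.Wcx_one, Units.val_one, sub_self, norm_zero]
  exact zero_lt_one

end Average

/-! ## §3  The linearised average (120)–(122) ∕ (127), jointly in the background and the field -/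

section Linear

variable (L : ℕ)
variable {V : Z → Site d → Fin d → 𝔸ˣ} {A : Z → Site d → Fin d → 𝔸} {z₀ : Z} (hV : ContinuousAt V z₀) (hA : ContinuousAt A z₀)

omit [NormOneClass 𝔸] [NormedAlgebra ℂ 𝔸] [CompleteSpace 𝔸] in
include hA in
/-- a field value of a family of fields continuous at `z₀` is continuous at `z₀`. [cite: Balaban1985Averaging, (58) p.27 (bookkeeping)] -/
theorem continuousAt_field (x : Site d) (μ : Fin d) : ContinuousAt (fun z => A z x μ) z₀ := by
  have h : Continuous fun B : Site d → Fin d → 𝔸 => B x μ := (continuous_apply μ).comp (continuous_apply x)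
  exact h.continuousAt.comp hA

omit [NormOneClass 𝔸] [NormedAlgebra ℂ 𝔸] [CompleteSpace 𝔸] in
/-- «R(X)Y = XYX⁻¹» along arguments continuous at `z₀`. [cite: Balaban1985Averaging, (58) p.27 («R(V₀(Γ))A»)] -/
theorem continuousAt_conjR {f : Z → 𝔸ˣ} {g : Z → 𝔸} (hf : ContinuousAt f z₀) (hg : ContinuousAt g z₀) :
    ContinuousAt (fun z => conjR (f z) (g z)) z₀ := by
  unfold conjR
  exact ((Units.continuous_val.continuousAt.comp hf).mul hg).mul (Units.continuous_coe_inv.continuousAt.comp hf)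

include hV in
omit [NormOneClass 𝔸] [NormedAlgebra ℂ 𝔸] [CompleteSpace 𝔸] in
/-- the block small-field condition «all loop variables within `1` of `1`» is OPEN: it holds near `z₀` if it holds at `z₀`.
[cite: Balaban1985Averaging, (21) p.21, (42) p.23] -/
theorem eventually_Wcx_lt (q : Site d) (κ : Fin d) (h : ∀ r : Fin d → Fin L, ‖((Wcx L (V z₀) q κ (boxVec L r) : 𝔸ˣ) : 𝔸) - 1‖ < 1) :
    ∀ᶠ z in 𝓝 z₀, ∀ r : Fin d → Fin L, ‖((Wcx L (V z) q κ (boxVec L r) : 𝔸ˣ) : 𝔸) - 1‖ < 1 := by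
  refine eventually_all.2 fun r => ?_
  have hc : ContinuousAt (fun z => ‖((Wcx L (V z) q κ (boxVec L r) : 𝔸ˣ) : 𝔸) - 1‖) z₀ :=
    ((Units.continuous_val.continuousAt.comp (continuousAt_Wcx hV L q κ (boxVec L r))).sub continuousAt_const).norm
  exact hc.eventually (p := fun t : ℝ => t < 1) (isOpen_Iio.mem_nhds (h r))

include hV hA

omit [NormOneClass 𝔸] [NormedAlgebra ℂ 𝔸] [CompleteSpace 𝔸] in
/-- one letter of the rotated sum `(R_{0,y}A)(Γ)` is continuous in (background, field). [cite: Balaban1985Averaging, (58) p.27, p.28] -/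
theorem continuousAt_tstep (x : Site d) (l : Letter d) : ContinuousAt (fun z => tstep (V z) (A z) x l) z₀ := by
  unfold tstep
  by_cases h : l.2
  · simp only [h, if_true]; exact continuousAt_field hA x l.1
  · simp only [h]
    exact (continuousAt_conjR (continuousAt_stepHol hV x l) (continuousAt_field hA (x + l.vec) l.1)).neg

omit [NormOneClass 𝔸] [NormedAlgebra ℂ 𝔸] [CompleteSpace 𝔸] in
/-- ★ **THE ROTATED SUMS `(R_{0,y}A)(Γ) = Σ_{b⊂Γ} R(V₀(Γ_{y,b₋}))A_b` ARE CONTINUOUS IN (BACKGROUND, FIELD)** for every contour.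
[cite: Balaban1985Averaging, (58) p.27, p.28] -/
theorem continuousAt_tsum : ∀ (x : Site d) (w : List (Letter d)), ContinuousAt (fun z => tsum (V z) (A z) x w) z₀
  | x, [] => by simp only [B7Prop3GeneralRotated.tsum_nil]; exact continuousAt_const
  | x, l :: w => by
    simp only [B7Prop3GeneralRotated.tsum_cons]
    exact (continuousAt_tstep hV hA x l).add (continuousAt_conjR (continuousAt_stepHol hV x l) (continuousAt_tsum (x + l.vec) w))

omit [NormOneClass 𝔸] [CompleteSpace 𝔸] in
/-- **(112): `F̂_{V₀}(y) = Σ_{x∈B(y)} L^{−d}(R_{0,y}A)(Γ_{y,x})` IS CONTINUOUS IN (BACKGROUND, FIELD).** [cite: Balaban1985Averaging, (112) p.34] -/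
theorem continuousAt_FhatCov (y : Site d) : ContinuousAt (fun z => FhatCov L (V z) (A z) y) z₀ := by
  unfold FhatCov
  refine tendsto_finsetSum _ fun r _ => ?_
  exact (continuousAt_tsum hV hA y _).const_smul _

omit [NormOneClass 𝔸] [NormedAlgebra ℂ 𝔸] [CompleteSpace 𝔸] in
/-- **(114)–(115): the first-order loop functional `A_x^{(1)} = (R_{0,c₋}A)(Γ_{c,x}∪(−c))` IS CONTINUOUS IN (BACKGROUND, FIELD).** [cite: Balaban1985Averaging, (114)–(115) p.34] -/
theorem continuousAt_Aloop (q : Site d) (κ : Fin d) (r : Site d) : ContinuousAt (fun z => Aloop L (V z) (A z) q κ r) z₀ := by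
  unfold Aloop
  exact continuousAt_tsum hV hA q _

omit hV hA

/-- `D exp` is continuous (as a map into bounded operators): `exp` is analytic, hence `C¹`, and `Dexp` is its Fréchet derivative. [cite: Balaban1985Averaging, (117)–(119) p.35 («g(−i ad_Y)»)] -/
theorem continuous_Dexp : Continuous (Dexp : 𝔸 → 𝔸 →L[ℂ] 𝔸) := by
  have h : (Dexp : 𝔸 → 𝔸 →L[ℂ] 𝔸) = fderiv ℂ (exp : 𝔸 → 𝔸) := funext fun Y => ((hasFDerivAt_exp_Dexp Y).fderiv).symm
  rw [h]
  refine continuous_iff_continuousAt.2 fun Y => ?_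
  exact ((NormedSpace.exp_analytic (𝕂 := ℂ) Y).contDiffAt (n := 1)).continuousAt_fderiv one_ne_zero

omit [NormOneClass 𝔸] in
/-- `D log` is continuous inside the disc `‖W − 1‖ < 1` (the series (21) is analytic there and `Dmlog` is its Fréchet derivative).
[cite: Balaban1985Averaging, (21) p.21, (116) p.35 («g⁻¹(−i ad_{Y_x})»)] -/
theorem continuousAt_Dmlog {W : 𝔸} (hW : ‖W - 1‖ < 1) : ContinuousAt (Dmlog : 𝔸 → 𝔸 →L[ℂ] 𝔸) W := by
  have hopen : IsOpen {W' : 𝔸 | ‖W' - 1‖ < 1} := isOpen_lt (continuous_norm.comp (continuous_id.sub continuous_const)) continuous_const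
  have hev : (Dmlog : 𝔸 → 𝔸 →L[ℂ] 𝔸) =ᶠ[𝓝 W] fderiv ℂ (mlog : 𝔸 → 𝔸) := by
    filter_upwards [hopen.mem_nhds hW] with W' hW'
    exact ((hasFDerivAt_mlog hW').fderiv).symm
  exact (((analyticAt_mlog hW).contDiffAt (n := 1)).continuousAt_fderiv one_ne_zero).congr_of_eventuallyEq hev

include hV hA

omit [NormOneClass 𝔸] in
/-- **(117): the derivative `Σ_x L^{−d}(D log)_{W_x}(A_x^{(1)}W_x)` of the exponent of (42) IS CONTINUOUS IN (BACKGROUND, FIELD)** at backgrounds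
whose loop variables on the block are within `1` of `1`. [cite: Balaban1985Averaging, (117) p.35] -/
theorem continuousAt_DXavg (q : Site d) (κ : Fin d) (h : ∀ r : Fin d → Fin L, ‖((Wcx L (V z₀) q κ (boxVec L r) : 𝔸ˣ) : 𝔸) - 1‖ < 1) :
    ContinuousAt (fun z => DXavg L (V z) (A z) q κ) z₀ := by
  unfold DXavg
  refine tendsto_finsetSum _ fun r _ => ?_
  have hW : ContinuousAt (fun z => ((Wcx L (V z) q κ (boxVec L r) : 𝔸ˣ) : 𝔸)) z₀ :=
    Units.continuous_val.continuousAt.comp (continuousAt_Wcx hV L q κ (boxVec L r))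
  have hD : ContinuousAt (fun z => Dmlog ((Wcx L (V z) q κ (boxVec L r) : 𝔸ˣ) : 𝔸)) z₀ :=
    ContinuousAt.comp (g := Dmlog) (f := fun z => ((Wcx L (V z) q κ (boxVec L r) : 𝔸ˣ) : 𝔸)) (continuousAt_Dmlog (h r)) hW
  exact (hD.clm_apply ((continuousAt_Aloop L hV hA q κ (boxVec L r)).mul hW)).const_smul _

/-- **(119): `(Q′(V₀)A)_c` IS CONTINUOUS IN (BACKGROUND, FIELD)** at backgrounds whose loop variables on the block are within `1` of `1`.
[cite: Balaban1985Averaging, (119) p.35, (117)–(118) p.35] -/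
theorem continuousAt_QprimeCov (q : Site d) (κ : Fin d) (h : ∀ r : Fin d → Fin L, ‖((Wcx L (V z₀) q κ (boxVec L r) : 𝔸ˣ) : 𝔸) - 1‖ < 1) :
    ContinuousAt (fun z => QprimeCov L (V z) (A z) q κ) z₀ := by
  have hX := continuousAt_Xavg L hV q κ h
  have h1 : ContinuousAt (fun z => PhiY (Xavg L (V z) q κ) (DXavg L (V z) (A z) q κ)) z₀ := by
    simp only [PhiY_apply]
    have hD : ContinuousAt (fun z => Dexp (Xavg L (V z) q κ)) z₀ :=
      ContinuousAt.comp (g := Dexp) (f := fun z => Xavg L (V z) q κ) continuous_Dexp.continuousAt hX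
    have hE : ContinuousAt (fun z => exp (-Xavg L (V z) q κ)) z₀ := by
      letI : NormedAlgebra ℚ 𝔸 := NormedAlgebra.restrictScalars ℚ ℂ 𝔸
      exact ContinuousAt.comp (g := exp) (f := fun z => -Xavg L (V z) q κ) exp_continuous.continuousAt hX.neg
    exact (hD.clm_apply (continuousAt_DXavg L hV hA q κ h)).mul hE
  have h2 : ContinuousAt (fun z => conjR (expUnit (Xavg L (V z) q κ)) (tsum (V z) (A z) q (seg κ L))) z₀ :=
    continuousAt_conjR (ContinuousAt.comp (g := expUnit) (f := fun z => Xavg L (V z) q κ) continuous_expUnit.continuousAt hX)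
      (continuousAt_tsum hV hA q _)
  unfold QprimeCov
  exact h1.add h2

/-- ★★ **(122): THE LINEARISED AVERAGE «L(Q(V₀)A)_c» IS CONTINUOUS IN (BACKGROUND, FIELD)** at every background whose loop variables on the block
`B(c₋)` are within `1` of `1` — there it is given by the closed form (120) (`B7Prop3GeneralTild.linQcov_eq`), a finite composition of the continuous
pieces above; the closed form holds on a neighbourhood (the condition is open). [cite: Balaban1985Averaging, (122) p.36, (120) p.35] -/
theorem continuousAt_linQcov (q : Site d) (κ : Fin d) (h : ∀ r : Fin d → Fin L, ‖((Wcx L (V z₀) q κ (boxVec L r) : 𝔸ˣ) : 𝔸) - 1‖ < 1) :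
    ContinuousAt (fun z => linQcov L (V z) (A z) q κ) z₀ := by
  have hg : ContinuousAt (fun z => -FhatCov L (V z) (A z) q + QprimeCov L (V z) (A z) q κ
      + conjR (bavg L (V z) q κ) (FhatCov L (V z) (A z) (q + (L : ℤ) • e κ))) z₀ :=
    ((continuousAt_FhatCov L hV hA q).neg.add (continuousAt_QprimeCov L hV hA q κ h)).add
      (continuousAt_conjR (continuousAt_bavg L hV q κ h) (continuousAt_FhatCov L hV hA _))
  refine hg.congr_of_eventuallyEq ?_
  filter_upwards [eventually_Wcx_lt L hV q κ h] with z hz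
  exact linQcov_eq L (V z) (A z) q κ hz

end Linear

/-! ## §4  (127): the composite linearised averaging `Q_j(U₀)A`, jointly in (background, field) -/

section Levels

variable (L : ℕ)

/-- ★★★ **(127): `(U₀, B) ↦ Q_j(U₀)B` IS CONTINUOUS** (`B7Prop4GeneralLevels.linCovIter`, as a map into fields with the product topology) at every
`(U₁, B₁)` such that all loop variables of every lower average `Ū₁ⁱ`, `i < j`, are within `1` of `1` — the composite of `j` linearised one-step
averages (122) over the backgrounds `Ū₀ⁱ` (43), each continuous by §2–§3. [cite: Balaban1985Averaging, (127) p.37, (122) p.36, (43) p.24] -/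
theorem continuousAt_linCovIter {U : Z → Site d → Fin d → 𝔸ˣ} {B : Z → Site d → Fin d → 𝔸} {z₀ : Z} (hU : ContinuousAt U z₀)
    (hB : ContinuousAt B z₀) :
    ∀ j : ℕ, (∀ i, i < j → ∀ (q : Site d) (κ : Fin d) (r : Fin d → Fin L),
      ‖((Wcx L (avgIter L (U z₀) i) q κ (boxVec L r) : 𝔸ˣ) : 𝔸) - 1‖ < 1) →
      ContinuousAt (fun z => linCovIter L (U z) (B z) j) z₀
  | 0, _ => by simp only [linCovIter_zero]; exact hB
  | j + 1, h => by
    have hj := continuousAt_linCovIter hU hB j fun i hi => h i (Nat.lt_succ_of_lt hi)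
    have hV : ContinuousAt (fun z => avgIter L (U z) j) z₀ :=
      ContinuousAt.comp (g := fun V : Site d → Fin d → 𝔸ˣ => avgIter L V j) (f := U)
        (continuousAt_avgIter L j fun i hi => h i (Nat.lt_succ_of_lt hi)) hU
    refine continuousAt_pi.2 fun z => continuousAt_pi.2 fun κ => ?_
    simp only [linCovIter_succ]
    exact continuousAt_linQcov L hV hj ((L : ℤ) • z) κ fun r => h j (Nat.lt_succ_self j) ((L : ℤ) • z) κ r

/-- ★ **AT THE FLAT BACKGROUND `U₀ ↦ Q_j(U₀)B` IS CONTINUOUS** for every fixed field `B` and every `j` (all averages of `1` are `1`).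
[cite: Balaban1985Averaging, (127) p.37] -/
theorem continuousAt_linCovIter_one (B : Site d → Fin d → 𝔸) (j : ℕ) :
    ContinuousAt (fun U₀ : Site d → Fin d → 𝔸ˣ => linCovIter L U₀ B j) 1 := by
  refine continuousAt_linCovIter L continuousAt_id continuousAt_const j fun i _ q κ r => ?_
  rw [id, B8Ineq132.avgIter_one, B8Ineq130.Wcx_one, Units.val_one, sub_self, norm_zero]
  exact zero_lt_one

end Levels

end Literature.MathematicalPhysics.QuantumFieldTheory.Balaban1983to89.B7Eq43AveragingContinuity

end
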